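import Summits.Parity.GeneralizedHardyLittlewood.Theorems.BeyondDiagonalBeatsQuarter.OffDiagLevelFactorForm
import HarnessLib

/-!
# Route `PrimeLevelFamEdge`, crux K_B (stmt-Parity-20343), line `diagonal_kernel_split` rev 4, plan Ω,
# node **L7c, part 5 — the level-factor separation UNIFORMLY ON A BOX** (OMEGA-BLUEPRINT v4 §3c; companion of
# `OffDiagLevelPhaseCost` / `OffDiagLevelFactorForm`)

`OffDiagLevelPhaseCost.levelFactor_separation` separates `Σ_q c_q Ψ(1/q)` for the level factor
`Ψ(v) = W(av)J₁(bv)e(−κv)` on a sub-block of length `ℓ ≤ ρ(b,κ)/2`, `ρ(b,κ) = v₀/(1 + 2|b|v₀ + 4π|κ|v₀)`.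
Under the box integral of `OffDiagLevelFactorForm.sum_mul_fourier2_boxWeight_eq` the parameters move with the box point
`t = (t₁,t₂) ∈ [K₁/2, 2K₁] × [K₂/2, 2K₂]`: `a(t) = 4π²d₁t₁d₂t₂`, `b(t) = 4π√(αt₁βt₂)/c`, `κ(t) = t₁X₁ + t₂X₂`. This file
makes the separation UNIFORM in `t`:

* `levelRadius_antitone` — `ρ` is antitone in `|b|` and `|κ|`;
* `bParam_le_box`, `abs_kappa_le_box`, `aParam_pos_box` — on the box `0 ≤ b(t) ≤ b_max := 4π√(αβ(2K₁)(2K₂))/c`,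
  `|κ(t)| ≤ κ_max := 2K₁|X₁| + 2K₂|X₂|`, `a(t) > 0`;
* **`levelFactor_separation_box`** — with `ρ_min := v₀/(1 + 2 b_max v₀ + 4π κ_max v₀)` and ONE sub-block
  `[t₀, t₀+ℓ] ⊆ [v₀, 2v₀]`, `ℓ ≤ ρ_min/2`, `J ≥ 1`: for EVERY `t` in the box and every finite sample family `t_q ∈ [t₀,t₀+ℓ]`
  with weights `c_q`, `‖Σ_q c_q Ψ_t(t_q) − Σ_{j<J} C_j(t)·Σ_q c_q((t_q − t₀)/ℓ)ʲ‖ ≤ J·2^{−J}·Σ‖c_q‖` and `‖C_j(t)‖ ≤ 2^{−j}`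
  — the universal sequences do not depend on `t`, so the consumer's large-sieve functional bound runs pointwise in `t`
  under `∫dt₁∫dt₂` and is integrated at the end (no parametric derivative is ever integrated on its own).

Helper; closes nothing; standard axioms. «The programme SEARCHES and TYPES; no claim about Landau–Siegel zeros,
Theorems 1–2 of arXiv:2211.02515 or a repaired Margin232 until a kernel theorem says so.»
-/

noncomputable section

open Finset Real Complex
open scoped Nat

namespace Summit.Parity.GeneralizedHardyLittlewood.Theorems.BeyondDiagonalBeatsQuarter.LevelSeparation

open Literature.Analysis.FunctionSpaces (besselJ)
open Literature.NumberTheory.LFunctions.KMV2000 (cutoffW)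

/-! ### Monotonicity of the radius and the box bounds for the parameters -/

/-- **The radius `ρ(b,κ) = v₀/(1 + 2|b|v₀ + 4π|κ|v₀)` is antitone in `|b|`, `|κ|`**: if `|b| ≤ B` and `|κ| ≤ K`
(`v₀ > 0`) then `v₀/(1 + 2Bv₀ + 4πKv₀) ≤ ρ(b,κ)`. [folklore] -/
theorem levelRadius_antitone {v₀ b κ B K : ℝ} (hv₀ : 0 < v₀) (hb : |b| ≤ B) (hκ : |κ| ≤ K) :
    v₀ / (1 + 2 * B * v₀ + 4 * π * K * v₀) ≤ v₀ / (1 + 2 * |b| * v₀ + 4 * π * |κ| * v₀) := by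
  have h0 : 0 < 1 + 2 * |b| * v₀ + 4 * π * |κ| * v₀ := by positivity
  refine div_le_div_of_nonneg_left hv₀.le h0 ?_
  nlinarith [abs_nonneg b, abs_nonneg κ, Real.pi_pos, mul_nonneg Real.pi_pos.le hv₀.le]

/-- On the box `t_j ≤ 2K_j` (`t_j ≥ 0`): `0 ≤ b(t) = 4π√(αt₁βt₂)/c ≤ 4π√(αβ(2K₁)(2K₂))/c`. [folklore] -/
theorem bParam_le_box (α β c : ℕ) {K₁ K₂ t₁ t₂ : ℝ} (ht₁ : 0 ≤ t₁) (ht₁' : t₁ ≤ 2 * K₁) (ht₂ : 0 ≤ t₂)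
    (ht₂' : t₂ ≤ 2 * K₂) :
    |4 * π * Real.sqrt ((α : ℝ) * t₁ * ((β : ℝ) * t₂)) / c| ≤
      4 * π * Real.sqrt ((α : ℝ) * β * (2 * K₁) * (2 * K₂)) / c := by
  have hnn : 0 ≤ 4 * π * Real.sqrt ((α : ℝ) * t₁ * ((β : ℝ) * t₂)) / c := by positivity
  rw [abs_of_nonneg hnn]
  have hle : (α : ℝ) * t₁ * ((β : ℝ) * t₂) ≤ (α : ℝ) * β * (2 * K₁) * (2 * K₂) := by
    have hα : (0 : ℝ) ≤ α := Nat.cast_nonneg α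
    have hβ : (0 : ℝ) ≤ β := Nat.cast_nonneg β
    calc (α : ℝ) * t₁ * ((β : ℝ) * t₂) = ((α : ℝ) * β) * (t₁ * t₂) := by ring
      _ ≤ ((α : ℝ) * β) * ((2 * K₁) * (2 * K₂)) :=
          mul_le_mul_of_nonneg_left (mul_le_mul ht₁' ht₂' ht₂ (by linarith)) (by positivity)
      _ = (α : ℝ) * β * (2 * K₁) * (2 * K₂) := by ring
  have hs := Real.sqrt_le_sqrt hle
  have hc : (0 : ℝ) ≤ (c : ℝ)⁻¹ := inv_nonneg.2 (Nat.cast_nonneg c)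
  rw [div_eq_mul_inv, div_eq_mul_inv]
  exact mul_le_mul_of_nonneg_right (mul_le_mul_of_nonneg_left hs (by positivity)) hc

/-- On the box `|t_j| ≤ 2K_j`: `|κ(t)| = |t₁X₁ + t₂X₂| ≤ 2K₁|X₁| + 2K₂|X₂|`. [folklore] -/
theorem abs_kappa_le_box {K₁ K₂ t₁ t₂ : ℝ} (X₁ X₂ : ℝ) (ht₁ : |t₁| ≤ 2 * K₁) (ht₂ : |t₂| ≤ 2 * K₂) :
    |t₁ * X₁ + t₂ * X₂| ≤ 2 * K₁ * |X₁| + 2 * K₂ * |X₂| := by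
  calc |t₁ * X₁ + t₂ * X₂| ≤ |t₁ * X₁| + |t₂ * X₂| := abs_add_le _ _
    _ = |t₁| * |X₁| + |t₂| * |X₂| := by rw [abs_mul, abs_mul]
    _ ≤ 2 * K₁ * |X₁| + 2 * K₂ * |X₂| :=
        add_le_add (mul_le_mul_of_nonneg_right ht₁ (abs_nonneg _)) (mul_le_mul_of_nonneg_right ht₂ (abs_nonneg _))

/-- On the open quadrant (`t₁, t₂ > 0`, `d₁, d₂ ≥ 1`): `a(t) = 4π²d₁t₁d₂t₂ > 0`. [folklore] -/
theorem aParam_pos_box {d₁ d₂ : ℕ} (hd₁ : 1 ≤ d₁) (hd₂ : 1 ≤ d₂) {t₁ t₂ : ℝ} (ht₁ : 0 < t₁) (ht₂ : 0 < t₂) :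
    0 < 4 * π ^ 2 * ((d₁ : ℝ) * t₁ * ((d₂ : ℝ) * t₂)) := by
  have h1 : (0 : ℝ) < d₁ := by exact_mod_cast hd₁
  have h2 : (0 : ℝ) < d₂ := by exact_mod_cast hd₂
  positivity

/-! ### The separation, uniformly on the box -/

/-- **Separation of the level factor, uniformly on the box.** Data: a layer `(d₁,d₂)` (`≥ 1`), frequency parameters
`α, β`, layer modulus index `c`, the box `[K₁/2,2K₁]×[K₂/2,2K₂]` (`K_j > 0`), the dual-point data `X₁, X₂`, the window
`[v₀, 2v₀]` (`v₀ > 0`) and ONE sub-block `[t₀, t₀+ℓ] ⊆ [v₀,2v₀]` with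
`0 < ℓ ≤ ρ_min/2`, `ρ_min = v₀/(1 + 2·(4π√(αβ(2K₁)(2K₂))/c)·v₀ + 4π·(2K₁|X₁| + 2K₂|X₂|)·v₀)`, and `J ≥ 1`. Then for
every box point `t` and every finite sample family `t_q ∈ [t₀,t₀+ℓ]` with weights `c_q`, the level factor
`Ψ_t(v) = W(a(t)v)·J₁(b(t)v)·e(−κ(t)v)` satisfies
`‖Σ_q c_qΨ_t(t_q) − Σ_{j<J} C_j(t)·Σ_q c_q((t_q−t₀)/ℓ)ʲ‖ ≤ J·2^{−J}·Σ‖c_q‖` with `‖C_j(t)‖ ≤ 2^{−j}`,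
`C_j(t) = (ℓʲ/j!)Ψ_t^{(j)}(t₀)`. [cite: KowalskiMichelVanderKam2000, (21)–(23) p. 12 — derivation] -/
theorem levelFactor_separation_box {d₁ d₂ : ℕ} (hd₁ : 1 ≤ d₁) (hd₂ : 1 ≤ d₂) (α β c : ℕ) {K₁ K₂ : ℝ}
    (hK₁ : 0 < K₁) (hK₂ : 0 < K₂) (X₁ X₂ : ℝ) {v₀ t₀ ℓ : ℝ} (hv₀ : 0 < v₀) (hℓ : 0 < ℓ) (ht₀ : v₀ ≤ t₀)
    (ht₁ : t₀ + ℓ ≤ 2 * v₀)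
    (hℓρ : ℓ ≤ v₀ / (1 + 2 * (4 * π * Real.sqrt ((α : ℝ) * β * (2 * K₁) * (2 * K₂)) / c) * v₀ +
      4 * π * (2 * K₁ * |X₁| + 2 * K₂ * |X₂|) * v₀) / 2)
    {J : ℕ} (hJ : 1 ≤ J) {t₁ t₂ : ℝ} (ht₁b : t₁ ∈ Set.Icc (K₁ / 2) (2 * K₁)) (ht₂b : t₂ ∈ Set.Icc (K₂ / 2) (2 * K₂))
    {ι : Type*} (S : Finset ι) (cw : ι → ℂ) (t : ι → ℝ) (ht : ∀ i ∈ S, t i ∈ Set.Icc t₀ (t₀ + ℓ)) :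
    ‖∑ i ∈ S, cw i *
          ((cutoffW ((4 * π ^ 2 * ((d₁ : ℝ) * t₁ * ((d₂ : ℝ) * t₂))) * t i) : ℂ) *
            (besselJ 1 ((4 * π * Real.sqrt ((α : ℝ) * t₁ * ((β : ℝ) * t₂)) / c) * t i) : ℂ) *
              Complex.exp (((-2 * π * (t₁ * X₁ + t₂ * X₂) * t i : ℝ) : ℂ) * I)) -
        ∑ j ∈ Finset.range J,
          (((ℓ ^ j / j ! : ℝ) : ℂ) * iteratedDeriv j (fun v : ℝ =>
              (cutoffW ((4 * π ^ 2 * ((d₁ : ℝ) * t₁ * ((d₂ : ℝ) * t₂))) * v) : ℂ) *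
                (besselJ 1 ((4 * π * Real.sqrt ((α : ℝ) * t₁ * ((β : ℝ) * t₂)) / c) * v) : ℂ) *
                  Complex.exp (((-2 * π * (t₁ * X₁ + t₂ * X₂) * v : ℝ) : ℂ) * I)) t₀) *
            ∑ i ∈ S, cw i * ((((t i - t₀) / ℓ) ^ j : ℝ) : ℂ)‖ ≤
        J * (1 / 2) ^ J * ∑ i ∈ S, ‖cw i‖ ∧
      ∀ j : ℕ, ‖((ℓ ^ j / j ! : ℝ) : ℂ) * iteratedDeriv j (fun v : ℝ =>
          (cutoffW ((4 * π ^ 2 * ((d₁ : ℝ) * t₁ * ((d₂ : ℝ) * t₂))) * v) : ℂ) *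
            (besselJ 1 ((4 * π * Real.sqrt ((α : ℝ) * t₁ * ((β : ℝ) * t₂)) / c) * v) : ℂ) *
              Complex.exp (((-2 * π * (t₁ * X₁ + t₂ * X₂) * v : ℝ) : ℂ) * I)) t₀‖ ≤ (1 / 2) ^ j := by
  -- the parameters at the box point
  have ht₁0 : 0 < t₁ := lt_of_lt_of_le (by positivity) ht₁b.1
  have ht₂0 : 0 < t₂ := lt_of_lt_of_le (by positivity) ht₂b.1
  have ha : 0 < 4 * π ^ 2 * ((d₁ : ℝ) * t₁ * ((d₂ : ℝ) * t₂)) := aParam_pos_box hd₁ hd₂ ht₁0 ht₂0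
  have hb : |4 * π * Real.sqrt ((α : ℝ) * t₁ * ((β : ℝ) * t₂)) / c| ≤
      4 * π * Real.sqrt ((α : ℝ) * β * (2 * K₁) * (2 * K₂)) / c :=
    bParam_le_box α β c ht₁0.le ht₁b.2 ht₂0.le ht₂b.2
  have hκ : |t₁ * X₁ + t₂ * X₂| ≤ 2 * K₁ * |X₁| + 2 * K₂ * |X₂| :=
    abs_kappa_le_box X₁ X₂ (by rw [abs_of_pos ht₁0]; exact ht₁b.2) (by rw [abs_of_pos ht₂0]; exact ht₂b.2)
  -- the radius at `t` dominates `ρ_min`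
  have hρ := levelRadius_antitone hv₀ hb hκ
  have hℓρ' : ℓ ≤ v₀ / (1 + 2 * |4 * π * Real.sqrt ((α : ℝ) * t₁ * ((β : ℝ) * t₂)) / c| * v₀ +
      4 * π * |t₁ * X₁ + t₂ * X₂| * v₀) / 2 := hℓρ.trans (by linarith)
  exact levelFactor_separation ha _ _ hv₀ hℓ ht₀ ht₁ hℓρ' hJ S cw t ht

end Summit.Parity.GeneralizedHardyLittlewood.Theorems.BeyondDiagonalBeatsQuarter.LevelSeparation

end
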